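/-
Origin: expansion seat `planner-pub-hodgecm-pv09-g7-0`, handover #5 v2 14:35:27Z (md5 259fdf5598ddeb51851382b4aa586992; NEW additive leaf; NO import rewrite needed — imports already tree-form HodgeCM.PerL34.GenuineSchrodingerSchwartzDense (pv13-g5 RUN-30 #6 1f97a611) + HodgeCM.PerL34.GenuineSchrodingerTensor (pv13-g5 RUN-30 #2 ddb86af1); land AFTER both; HOLD iff either is held; independent of every other RUN-31 row) (`HOME/pub-hodgecm-pv09-g7/lean/Pv09g7/RestrictedTensorDense.lean`, md5 259fdf55, 372 lines);
landed by the gen-8 packager in gate run 31 as `HodgeCM/PerL34/RestrictedTensorDense.lean` (verbatim).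
-/
/-
Copyright: HodgeCM publication cell (pub-hodgecm), seam S3 (𝓕-side; the `⊗′`-model lineage pv09).  Prover seat
pub-hodgecm-pv09-g7 (DAG-node prover #09, generation 7), file #5, node `RestrictedTensorDense`; intended final place
`HodgeCM/PerL34/RestrictedTensorDense.lean`.
Imports (both RUN-30 rows, referenced in their as-landed names): `HodgeCM.PerL34.GenuineSchrodingerSchwartzDense`
(pv13-g5 #6, 1f97a611) and `HodgeCM.PerL34.GenuineSchrodingerTensor` (pv13-g5 #2, ddb86af1).  Complete proofs, no new
axioms, nothing cited.  Released under the package licence.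

**`L²(X) = ⊗̂′_v L²((L⁺_v)³)`** — the isometric embedding
`tensorIso L : ⊗′_v (L²((L⁺_v)³), 1_{𝒪_v³}) →ₗᵢ L²(X, μ)` of `GenuineSchrodingerTensor` is SURJECTIVE, hence a
unitary equivalence `tensorEquiv L`, intertwining the global dilation representation `ω = rep L 1` with the restricted
tensor product `⊗′_v ω_v = repTensor L` of the local ones.

Mathematical content (published inputs only — Weil 1964 no. 11 / MVW ch. 2 §I.3: the compact open subsets of a
restricted product of local fields form a basis and every compact open set is a finite disjoint union of "boxes"):
* §1  cosets `y + B_k` of the level balls (`levelBall`, `ballCoset`): two cosets of one level are equal or disjoint; a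
      compact open `A ⊆ X` admits ONE level `k` with `y + B_k ⊆ A` for all `y ∈ A`
      (`compact_open_separated_add_right` + `levelBall_nhds`), hence is a finite disjoint union of `B_k`-cosets;
* §2  the indicator of a coset `y + B_k` is a PURE TENSOR: `1_{y + B_k} = tensorIso (⊗_v 1_{closedBall(y_v, rad k v)})`,
      the local factor being `1_{𝒪_v³}` at every place off the finite exceptional set (index `< k` or `y_v ∉ 𝒪_v³`);
* §3  so every `indCO A` lies in the span of the pure tensors, the density criterion
      `Coeff.topologicalClosure_eq_top_of_indCO_mem` makes that span dense, and the range of the isometry `tensorIso`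
      is closed (`range_tensorToL2`) — it is everything; §4 packages the `LinearIsometryEquiv` and its equivariance.
Kernel-checked with no placeholders, no axiom beyond `[propext, Classical.choice, Quot.sound]`, no new instance,
additive kernel leaf (nothing in the tree imports it).
-/
import Summits.HodgeConjecture.HodgeCM.PerL34.GenuineSchrodingerSchwartzDense_2
import Summits.HodgeConjecture.HodgeCM.PerL34.GenuineSchrodingerTensor_2

noncomputable section

open MeasureTheory MeasureTheory.Measure Set Metric Function Complex Topology Filter
open scoped RestrictedProduct InnerProductSpace NNReal ENNReal Pointwise

namespace HodgeCM.PerL34.PureTensor.SchrodingerModel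

open HodgeCM.PerL34.LocalFactors HodgeCM.PerL34.LocalFactors.DilationModel
open HodgeCM.PerL34.IdelePlaces HodgeCM.PerL34.IdelicTorusModel HodgeCM.PerL34.IdelicTorusModel.Genuine
open HodgeCM.PerL34.RestrictedTensor HodgeCM.PerL34.RestrictedTensor.ProdL2 NumberField IsDedekindDomain

attribute [local instance] LocalFactors.DilationModel.Adic.nontriviallyNormedField
  LocalFactors.DilationModel.Adic.properSpace

variable {L : Type} [Field L] [NumberField L] [IsCMField L]

local notation3 "L⁺" => maximalRealSubfield L

namespace TensorDense

/-! ## §1  Cosets of the level balls; compact open sets are finite disjoint unions of them -/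

/-- (Ported verbatim from the HodgeCMPerL package; no docstring in the source.) -/
theorem mem_ballCoset_iff {y w : Space L} {k : ℕ} : w ∈ ballCoset L y k ↔ w - y ∈ levelBall L k := by
  constructor
  · rintro ⟨v, hv, rfl⟩
    simpa only [add_sub_cancel_left, SetLike.mem_coe] using hv
  · intro h
    exact ⟨w - y, h, add_sub_cancel y w⟩

/-- (Ported verbatim from the HodgeCMPerL package; no docstring in the source.) -/
theorem mem_ballCoset_iff_norm {y w : Space L} {k : ℕ} :
    w ∈ ballCoset L y k ↔ ∀ i, ‖w i - y i‖ ≤ rad L k i := by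
  rw [mem_ballCoset_iff, mem_levelBall_iff]
  rfl

/-- a coset of `B_k` through a point of another one IS that one -/
theorem ballCoset_eq_of_mem {y z : Space L} {k : ℕ} (h : z ∈ ballCoset L y k) :
    ballCoset L z k = ballCoset L y k := by
  rw [mem_ballCoset_iff] at h
  ext w
  rw [mem_ballCoset_iff, mem_ballCoset_iff]
  constructor
  · intro hw
    have h' := (levelBall L k).add_mem hw h
    rwa [sub_add_sub_cancel] at h'
  · intro hw
    have h' := (levelBall L k).sub_mem hw h
    rwa [sub_sub_sub_cancel_right] at h'

/-- **two cosets of one level are disjoint or equal** -/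
theorem ballCoset_disjoint_or_eq (y z : Space L) (k : ℕ) :
    Disjoint (ballCoset L y k) (ballCoset L z k) ∨ ballCoset L y k = ballCoset L z k := by
  rw [or_iff_not_imp_left, Set.not_disjoint_iff]
  rintro ⟨w, hwy, hwz⟩
  rw [← ballCoset_eq_of_mem hwy]
  exact ballCoset_eq_of_mem hwz

/-- the cosets through a point decrease with the level -/
theorem ballCoset_anti {y : Space L} {k j : ℕ} (h : k ≤ j) : ballCoset L y j ⊆ ballCoset L y k :=
  fun _ hw => mem_ballCoset_iff.2 (levelBall_antitone L h (mem_ballCoset_iff.1 hw))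

/-- **a compact open set has a uniform level**: one `k` with `y + B_k ⊆ A` for every `y ∈ A` -/
theorem exists_level {A : Set (Space L)} (hA : IsCompact A) (hA' : IsOpen A) :
    ∃ k, ∀ y ∈ A, ballCoset L y k ⊆ A := by
  obtain ⟨V, hV, hAV⟩ := compact_open_separated_add_right hA hA' Subset.rfl
  obtain ⟨k, hk⟩ := levelBall_nhds L V hV
  refine ⟨k, fun y hy => ?_⟩
  rintro _ ⟨v, hv, rfl⟩
  exact hAV (Set.add_mem_add hy (hk hv))

/-- **a compact open set is a finite disjoint union of cosets of one level ball**: a finite set `𝒞` of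
`B_k`-cosets of points of `A`, pairwise disjoint, with union `A` -/
theorem exists_coset_partition {A : Set (Space L)} (hA : IsCompact A) (hA' : IsOpen A) :
    ∃ (k : ℕ) (𝒞 : Finset (Set (Space L))), (∀ S ∈ 𝒞, ∃ y ∈ A, S = ballCoset L y k) ∧
      (↑𝒞 : Set (Set (Space L))).PairwiseDisjoint id ∧ A = ⋃ S ∈ 𝒞, S := by
  classical
  obtain ⟨k, hk⟩ := exists_level hA hA'
  obtain ⟨t, htA, hcov⟩ := hA.elim_nhds_subcover (fun y => ballCoset L y k) fun y _ => ballCoset_mem_nhds y k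
  refine ⟨k, t.image fun y => ballCoset L y k, fun S hS => ?_, fun S hS S' hS' hne => ?_, ?_⟩
  · obtain ⟨y, hy, rfl⟩ := Finset.mem_image.1 hS
    exact ⟨y, htA y hy, rfl⟩
  · obtain ⟨y, -, rfl⟩ := Finset.mem_image.1 (Finset.mem_coe.1 hS)
    obtain ⟨z, -, rfl⟩ := Finset.mem_image.1 (Finset.mem_coe.1 hS')
    exact (ballCoset_disjoint_or_eq y z k).resolve_right hne
  · rw [Finset.set_biUnion_finset_image]
    refine Subset.antisymm hcov (Set.iUnion₂_subset fun y hy => hk y (htA y hy))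

/-! ## §2  The indicator of a coset `y + B_k` is a pure tensor -/

/-- the exceptional indices of the coset `y + B_k`: index `< k` (radius `2^{-k}`), or `y_v ∉ 𝒪_v³` -/
def exc (y : Space L) (k : ℕ) : Finset (SplitIdx L) :=
  ((finite_enumIdx_lt L k).union (Filter.eventually_cofinite.1 y.2)).toFinset

/-- (Ported verbatim from the HodgeCMPerL package; no docstring in the source.) -/
theorem not_mem_exc_iff {y : Space L} {k : ℕ} {i : SplitIdx L} :
    i ∉ exc y k ↔ ¬ enumIdx L i < k ∧ y i ∈ (cube L i : Set (Coord L i)) := by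
  rw [exc, Set.Finite.mem_toFinset, Set.mem_union, not_or, Set.mem_setOf_eq, Set.mem_setOf_eq, not_not]
  rfl

/-- (Ported verbatim from the HodgeCMPerL package; no docstring in the source.) -/
theorem rad_eq_one_of_not_mem_exc {y : Space L} {k : ℕ} {i : SplitIdx L} (hi : i ∉ exc y k) : rad L k i = 1 :=
  rad_of_not_lt (not_mem_exc_iff.1 hi).1

/-- (Ported verbatim from the HodgeCMPerL package; no docstring in the source.) -/
theorem mem_cube_of_not_mem_exc {y : Space L} {k : ℕ} {i : SplitIdx L} (hi : i ∉ exc y k) :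
    y i ∈ (cube L i : Set (Coord L i)) :=
  (not_mem_exc_iff.1 hi).2

/-- off the exceptional set the local ball of the coset is `𝒪_v³` (ultrametric: a radius-one ball about a point
of the unit ball is the unit ball) -/
theorem closedBall_eq_of_not_mem_exc {y : Space L} {k : ℕ} {i : SplitIdx L} (hi : i ∉ exc y k) :
    closedBall (y i) (rad L k i) = closedBall (0 : Coord L i) 1 := by
  rw [rad_eq_one_of_not_mem_exc hi]
  have h : y i ∈ closedBall (0 : Coord L i) 1 := by
    rw [← coe_cube]; exact mem_cube_of_not_mem_exc hi
  exact (IsUltrametricDist.closedBall_eq_of_mem h).symm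

/-- the coset `y + B_k` in coordinates: inside the cylinder of its exceptional set, cut by the local balls there -/
theorem mem_ballCoset_iff_exc {y w : Space L} {k : ℕ} :
    w ∈ ballCoset L y k ↔ w ∈ cylSet (cube L) (exc y k) ∧
      ∀ i ∈ exc y k, w i ∈ closedBall (y i) (rad L k i) := by
  rw [mem_ballCoset_iff_norm, mem_cylSet_iff]
  constructor
  · intro h
    refine ⟨fun i hi => ?_, fun i _ => mem_closedBall_iff_norm.2 (h i)⟩
    have h' : w i ∈ closedBall (y i) (rad L k i) := mem_closedBall_iff_norm.2 (h i)
    rw [closedBall_eq_of_not_mem_exc hi, ← coe_cube] at h'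
    exact h'
  · rintro ⟨hc, hb⟩ i
    by_cases hi : i ∈ exc y k
    · exact mem_closedBall_iff_norm.1 (hb i hi)
    · have h' : w i ∈ closedBall (y i) (rad L k i) := by
        rw [closedBall_eq_of_not_mem_exc hi, ← coe_cube]; exact hc i hi
      exact mem_closedBall_iff_norm.1 h'

/-- (Ported verbatim from the HodgeCMPerL package; no docstring in the source.) -/
theorem ballCoset_subset_cylSet (y : Space L) (k : ℕ) : ballCoset L y k ⊆ cylSet (cube L) (exc y k) :=
  fun _ hw => (mem_ballCoset_iff_exc.1 hw).1

/-- two indicator vectors of equal sets are equal (the set data enter `indicatorConstLp` only through proofs) -/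
theorem indicatorConstLp_set_congr {α : Type*} [MeasurableSpace α] {m : Measure α} {s t : Set α} (h : s = t)
    {hs : MeasurableSet s} {ht : MeasurableSet t} {hμs : m s ≠ ∞} {hμt : m t ≠ ∞} (c : ℂ) :
    indicatorConstLp 2 hs hμs c = indicatorConstLp 2 ht hμt c := by
  subst h; rfl

variable [∀ v : HeightOneSpectrum (𝓞 (maximalRealSubfield L)), MeasurableSpace (v.adicCompletion (maximalRealSubfield L))]
  [∀ v : HeightOneSpectrum (𝓞 (maximalRealSubfield L)), BorelSpace (v.adicCompletion (maximalRealSubfield L))]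

/-- (Ported verbatim from the HodgeCMPerL package; no docstring in the source.) -/
theorem ballIndicator_congr {i : SplitIdx L} {x x' : Coord L i} {r r' : ℝ} (h : closedBall x r = closedBall x' r') :
    ballIndicator (mloc L i) x r = ballIndicator (mloc L i) x' r' := by
  unfold ballIndicator
  exact indicatorConstLp_set_congr h 1

/-- the local factors `1_{closedBall(y_v, rad k v)} ∈ L²((L⁺_v)³)` of the coset `y + B_k` -/
def locInd (y : Space L) (k : ℕ) (i : SplitIdx L) : Lp ℂ 2 (mloc L i) := ballIndicator (mloc L i) (y i) (rad L k i)

/-- (Ported verbatim from the HodgeCMPerL package; no docstring in the source.) -/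
theorem coeFn_locInd (y : Space L) (k : ℕ) (i : SplitIdx L) :
    ⇑(locInd y k i) =ᵐ[mloc L i] (closedBall (y i) (rad L k i)).indicator fun _ => (1 : ℂ) := by
  unfold locInd ballIndicator
  exact indicatorConstLp_coeFn

/-- off the exceptional set the local factor is the reference vector `1_{𝒪_v³}` -/
theorem locInd_eq_of_not_mem_exc {y : Space L} {k : ℕ} {i : SplitIdx L} (hi : i ∉ exc y k) :
    locInd y k i = ballIndicator (mloc L i) 0 1 :=
  ballIndicator_congr (closedBall_eq_of_not_mem_exc hi)

/-- **the restricted family of local factors** `(1_{closedBall(y_v, rad k v)})_v` of the coset `y + B_k` -/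
def cosetVec (y : Space L) (k : ℕ) : RVec (locFam L) :=
  ⟨locInd y k, Filter.eventually_cofinite.2 ((exc y k).finite_toSet.subset fun i hi =>
    Finset.mem_coe.2 (by by_contra h; exact hi (locInd_eq_of_not_mem_exc h)))⟩

/-- (Ported verbatim from the HodgeCMPerL package; no docstring in the source.) -/
@[simp] theorem cosetVec_apply (y : Space L) (k : ℕ) (i : SplitIdx L) : cosetVec y k i = locInd y k i := rfl

/-- (Ported verbatim from the HodgeCMPerL package; no docstring in the source.) -/
theorem cosetVec_eq_of_not_mem_exc {y : Space L} {k : ℕ} {i : SplitIdx L} (hi : i ∉ exc y k) :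
    cosetVec y k i = ballIndicator (mloc L i) 0 1 :=
  locInd_eq_of_not_mem_exc hi

/-- a finite product of `{0,1}`-indicator values is the indicator of the conjunction -/
theorem prod_indicator_one_eq {ι : Type*} (s : Finset ι) (P : ι → Prop) [DecidablePred P] :
    ∏ i ∈ s, (if P i then (1 : ℂ) else 0) = if ∀ i ∈ s, P i then 1 else 0 := by
  split_ifs with h
  · exact Finset.prod_eq_one fun i hi => if_pos (h i hi)
  · obtain ⟨i, hi, hP⟩ : ∃ i ∈ s, ¬ P i := by
      by_contra h'
      exact h fun i hi => by_contra fun hP => h' ⟨i, hi, hP⟩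
    exact Finset.prod_eq_zero hi (if_neg hP)

/-- **the indicator of a level coset is a pure tensor**:
`tensorIso (⊗_v 1_{closedBall(y_v, rad k v)}) = 1_{y + B_k}` in `L²(X)` -/
theorem tensorIso_tp_cosetVec (y : Space L) (k : ℕ) :
    tensorIso L (tp (locFam L) (cosetVec y k)) =
      Coeff.indCO L (ballCoset L y k) (isCompact_ballCoset y k) (isOpen_ballCoset y k) := by
  classical
  set T := exc y k with hT_def
  have hT : ∀ i ∉ T, cosetVec y k i = ballIndicator (mloc L i) 0 1 := fun i hi => cosetVec_eq_of_not_mem_exc hi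
  -- on the cylinder, a.e., every local factor evaluates as the indicator of its ball
  have hloc : ∀ i : T, ∀ᵐ w ∂(μ L).restrict (cylSet (cube L) T),
      (cosetVec y k i.1 : Coord L i.1 → ℂ) (w i.1) =
        (closedBall (y i.1) (rad L k i.1)).indicator (fun _ => (1 : ℂ)) (w i.1) := fun i =>
    (quasiMeasurePreserving_apply (μ L) (μ_boxSet L) (mloc L) mloc_cube T i).ae_eq (coeFn_locInd y k i.1)
  have hall : ∀ᵐ w ∂(μ L), w ∈ cylSet (cube L) T → ∀ i : T,
      (cosetVec y k i.1 : Coord L i.1 → ℂ) (w i.1) =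
        (closedBall (y i.1) (rad L k i.1)).indicator (fun _ => (1 : ℂ)) (w i.1) :=
    (ae_restrict_iff' (isOpen_cylSet T).measurableSet).1 (eventually_all.2 hloc)
  have hind : ⇑(Coeff.indCO L (ballCoset L y k) (isCompact_ballCoset y k) (isOpen_ballCoset y k)) =ᵐ[μ L]
      (ballCoset L y k).indicator fun _ => (1 : ℂ) := by
    rw [Coeff.indCO]; exact indicatorConstLp_coeFn
  refine Lp.ext_iff.2 ?_
  filter_upwards [coeFn_tensorIso_tp (cosetVec y k) T hT, hind, hall] with w h1 h2 h3
  rw [h1, h2]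
  by_cases hw : w ∈ cylSet (cube L) T
  · rw [indicator_of_mem hw, Finset.prod_congr rfl fun i _ => h3 hw i]
    simp only [Set.indicator_apply, Finset.prod_coe_sort T fun i => if w i ∈ closedBall (y i) (rad L k i) then
      (1 : ℂ) else 0, prod_indicator_one_eq]
    by_cases hb : ∀ i ∈ T, w i ∈ closedBall (y i) (rad L k i)
    · rw [if_pos hb, if_pos (mem_ballCoset_iff_exc.2 ⟨hw, hb⟩)]
    · rw [if_neg hb, if_neg fun h => hb (mem_ballCoset_iff_exc.1 h).2]
  · rw [indicator_of_notMem hw, indicator_of_notMem fun h => hw (ballCoset_subset_cylSet y k h)]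

/-! ## §3  Density of the pure tensors and surjectivity of `tensorIso` -/

variable (L) in
/-- the span of the pure tensors `tensorIso (⊗_v f_v)` in `L²(X)` -/
def pureSpan : Submodule ℂ (Lp ℂ 2 (μ L)) :=
  Submodule.span ℂ (Set.range fun x : RVec (locFam L) => tensorIso L (tp (locFam L) x))

/-- (Ported verbatim from the HodgeCMPerL package; no docstring in the source.) -/
theorem indCO_ballCoset_mem_pureSpan (y : Space L) (k : ℕ) :
    Coeff.indCO L (ballCoset L y k) (isCompact_ballCoset y k) (isOpen_ballCoset y k) ∈ pureSpan L :=
  Submodule.subset_span ⟨cosetVec y k, tensorIso_tp_cosetVec y k⟩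

/-- **every indicator vector of a compact open set is a finite sum of pure tensors** -/
theorem indCO_mem_pureSpan (A : Set (Space L)) (hA : IsCompact A) (hA' : IsOpen A) :
    Coeff.indCO L A hA hA' ∈ pureSpan L := by
  classical
  obtain ⟨k, 𝒞, h𝒞, hdisj, hA𝒞⟩ := exists_coset_partition hA hA'
  -- compactness / openness of the members of `𝒞`
  have hco : ∀ S ∈ 𝒞, IsCompact S ∧ IsOpen S := fun S hS => by
    obtain ⟨y, -, rfl⟩ := h𝒞 S hS
    exact ⟨isCompact_ballCoset y k, isOpen_ballCoset y k⟩
  -- the indicator of `A` is the sum of the indicators of the members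
  have hsum : Coeff.indCO L A hA hA' = ∑ S ∈ 𝒞.attach, Coeff.indCO L S.1 (hco S.1 S.2).1 (hco S.1 S.2).2 := by
    refine Lp.ext_iff.2 ?_
    have h1 : ⇑(Coeff.indCO L A hA hA') =ᵐ[μ L] A.indicator fun _ => (1 : ℂ) := by
      rw [Coeff.indCO]; exact indicatorConstLp_coeFn
    have h2 : ∀ S : 𝒞, ⇑(Coeff.indCO L S.1 (hco S.1 S.2).1 (hco S.1 S.2).2) =ᵐ[μ L]
        S.1.indicator fun _ => (1 : ℂ) := fun S => by
      rw [Coeff.indCO]; exact indicatorConstLp_coeFn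
    filter_upwards [h1, coeFn_finset_sum_Lp 𝒞.attach
      (fun S : 𝒞 => Coeff.indCO L S.1 (hco S.1 S.2).1 (hco S.1 S.2).2), eventually_all.2 h2] with w hw1 hw2 hw3
    rw [hw1, hw2, Finset.sum_congr rfl fun S _ => hw3 S,
      Finset.sum_attach 𝒞 fun S => S.indicator (fun _ => (1 : ℂ)) w, hA𝒞]
    have h := Finset.indicator_biUnion 𝒞 id hdisj (f := fun _ => (1 : ℂ))
    simp only [id] at h
    rw [h]
  rw [hsum]
  refine Submodule.sum_mem _ fun S _ => ?_
  obtain ⟨y, -, hy⟩ := h𝒞 S.1 S.2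
  have h : Coeff.indCO L S.1 (hco S.1 S.2).1 (hco S.1 S.2).2 =
      Coeff.indCO L (ballCoset L y k) (isCompact_ballCoset y k) (isOpen_ballCoset y k) := by
    rw [Coeff.indCO, Coeff.indCO]; exact indicatorConstLp_set_congr hy 1
  rw [h]
  exact indCO_ballCoset_mem_pureSpan y k

/-- hence **the Schwartz–Bruhat space lies in the pure-tensor span**: every `f ∈ 𝒮(X)` is a finite linear
combination of factorizable vectors `⊗_v 1_{closedBall(y_v, rad k v)}` -/
theorem schwartzBruhat_le_pureSpan : Coeff.schwartzBruhat L ≤ pureSpan L :=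
  Submodule.span_le.2 (by rintro _ ⟨A, rfl⟩; exact indCO_mem_pureSpan A.1 A.2.1 A.2.2)

/-- **the pure tensors span a dense subspace of `L²(X)`** -/
theorem topologicalClosure_pureSpan : (pureSpan L).topologicalClosure = ⊤ :=
  Coeff.topologicalClosure_eq_top_of_indCO_mem _ (indCO_mem_pureSpan (L := L))

/-- (Ported verbatim from the HodgeCMPerL package; no docstring in the source.) -/
theorem dense_pureSpan : Dense (pureSpan L : Set (Lp ℂ 2 (μ L))) :=
  Submodule.dense_iff_topologicalClosure_eq_top.2 topologicalClosure_pureSpan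

/-- the range of `tensorIso` is the closure of the pure-tensor span -/
theorem range_tensorIso_eq_closure :
    Set.range (tensorIso L) = closure (pureSpan L : Set (Lp ℂ 2 (μ L))) := by
  have h := range_tensorToL2 (μ L) (μ_boxSet L) (mloc L) mloc_cube
  rw [LinearMap.coe_range] at h
  have htp : (Set.range (tpFun (μ L) (μ_boxSet L) (mloc L) mloc_cube)) =
      Set.range fun x : RVec (locFam L) => tensorIso L (tp (locFam L) x) :=
    congr_arg Set.range (funext fun x => (tensorToL2_tp (μ L) (μ_boxSet L) (mloc L) mloc_cube x).symm)
  rw [htp] at h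
  exact h

/-- **`tensorIso` IS ONTO**: `L²(X)` is the completed restricted tensor product of the local `L²` spaces -/
theorem surjective_tensorIso : Function.Surjective (tensorIso L) := by
  rw [← Set.range_eq_univ, range_tensorIso_eq_closure, ← Submodule.topologicalClosure_coe,
    topologicalClosure_pureSpan]
  rfl

/-- (Ported verbatim from the HodgeCMPerL package; no docstring in the source.) -/
theorem range_tensorIso : LinearMap.range (tensorIso L).toLinearMap = ⊤ :=
  LinearMap.range_eq_top.2 surjective_tensorIso

end TensorDense

/-! ## §4  The unitary equivalence and its equivariance -/

open TensorDense

variable [∀ v : HeightOneSpectrum (𝓞 (maximalRealSubfield L)), MeasurableSpace (v.adicCompletion (maximalRealSubfield L))]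
  [∀ v : HeightOneSpectrum (𝓞 (maximalRealSubfield L)), BorelSpace (v.adicCompletion (maximalRealSubfield L))]

variable (L) in
/-- **THE UNITARY EQUIVALENCE `⊗′_v (L²((L⁺_v)³), 1_{𝒪_v³}) ≃ₗᵢ[ℂ] L²(X, μ)`** extending `⊗_v f_v ↦ ∏_v f_v(x_v)` -/
def tensorEquiv : RestrictedTensor.Space (locFam L) ≃ₗᵢ[ℂ] Lp ℂ 2 (μ L) :=
  LinearIsometryEquiv.ofSurjective (tensorIso L) surjective_tensorIso

/-- (Ported verbatim from the HodgeCMPerL package; no docstring in the source.) -/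
theorem coe_tensorEquiv : ⇑(tensorEquiv L) = tensorIso L :=
  LinearIsometryEquiv.coe_ofSurjective _ _

/-- (Ported verbatim from the HodgeCMPerL package; no docstring in the source.) -/
@[simp] theorem tensorEquiv_apply (z : RestrictedTensor.Space (locFam L)) : tensorEquiv L z = tensorIso L z :=
  congr_fun coe_tensorEquiv z

/-- on pure tensors: `tensorEquiv (⊗ f) = 1_{cyl_T} ∏_{v ∈ T} f_v(x_v)` -/
theorem tensorEquiv_tp (x : RVec (locFam L)) (T : Finset (SplitIdx L))
    (hT : ∀ i ∉ T, x i = ballIndicator (mloc L i) 0 1) :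
    tensorEquiv L (tp (locFam L) x) = prodLp (μ L) (μ_boxSet L) (mloc L) mloc_cube T x := by
  rw [tensorEquiv_apply, tensorIso_tp x T hT]

/-- the vacuum goes to the distinguished vector `φ⁰ = 1_{∏_v 𝒪_v³}` -/
theorem tensorEquiv_vac : tensorEquiv L (tp (locFam L) (RVec.vac _)) = phi0 L := by
  rw [tensorEquiv_apply, tensorIso_vac]

/-- every vector of `L²(X)` is (the image of) a restricted tensor -/
theorem exists_tensor_eq (F : Lp ℂ 2 (μ L)) : ∃ z : RestrictedTensor.Space (locFam L), tensorIso L z = F :=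
  surjective_tensorIso F

/-- **EQUIVARIANCE of the equivalence**: `ω(k) ∘ tensorEquiv = tensorEquiv ∘ (⊗′_v ω_v)(k)` -/
theorem rep_tensorEquiv (k : Model L) (z : RestrictedTensor.Space (locFam L)) :
    rep L 1 k (tensorEquiv L z) = tensorEquiv L (repTensor L k z) := by
  rw [tensorEquiv_apply, tensorEquiv_apply, rep_tensorIso]

/-- **`ω ≅ ⊗′_v ω_v` as a unitary equivalence of representations of the model group**:
`tensorEquiv⁻¹ ∘ ω(k) ∘ tensorEquiv = (⊗′_v ω_v)(k)` -/
theorem tensorEquiv_symm_rep (k : Model L) (F : Lp ℂ 2 (μ L)) :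
    (tensorEquiv L).symm (rep L 1 k F) = repTensor L k ((tensorEquiv L).symm F) := by
  apply (tensorEquiv L).injective
  rw [LinearIsometryEquiv.apply_symm_apply, ← rep_tensorEquiv, LinearIsometryEquiv.apply_symm_apply]

/-- (Ported verbatim from the HodgeCMPerL package; no docstring in the source.) -/
theorem tensorEquiv_symm_rep_tensorEquiv (k : Model L) (z : RestrictedTensor.Space (locFam L)) :
    (tensorEquiv L).symm (rep L 1 k (tensorEquiv L z)) = repTensor L k z := by
  rw [tensorEquiv_symm_rep, LinearIsometryEquiv.symm_apply_apply]

end HodgeCM.PerL34.PureTensor.SchrodingerModel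

end
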